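import Summits.RiemannHypothesis.RiemannHypothesis.Theorems.JensenLogBandArcRadius
import Mathlib.Analysis.SpecialFunctions.Log.Basic
import Mathlib.Analysis.Complex.Basic
import HarnessLib

/-!
# Height perturbation of `ℓ_T` and of the band radius (BAND line, near zone: disc points `T′ ≠ T`)

RH ladder column JENSEN, rung J-P(P3) «log band», BAND crux `XiDerivBandRealAllRates` of route
«JensenLogBand», line «band-one-window» (u-arc, top-shell reshape), lead rh-jensen-prover g8 —
drafted by the custodian rh-jensen-theory g12 (THEORY NOTE #4 §1 step 0, §4; NOTE #3 §6 (W1)/(W2))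
for the lead / a hand to land verbatim `--supports stmt-RiemannHypothesis-19913 --as helper`.
RH-FREE real analysis. WHAT THIS IS NOT: nothing here bears on zeros of `ζ` or the truth of RH.

On the transfer discs of the near zone the height moves (`T′ = Im v`, `|T′ − T| ≤ 3/ℓ_T`), and with
it `ℓ_{T′}` and the pinned radius `h′ = bandRadius k T′`, while the transform keeps the FIXED radius
`h = bandRadius k T`. The fine bounds (NOT the crude `ℓ_{T′} ≥ ℓ_T − 1/10` of `ell_height_bounds`,
which cannot deliver the pin `½ ≤ h′` when `4/c − ½` is small):
* `ell_sub_ell_eq_log`, `ell_sub_ell_le`, `le_ell_sub_ell`, `abs_ell_sub_ell_le`: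
  `(T′−T)/T′ ≤ ℓ_{T′} − ℓ_T = log(T′/T) ≤ (T′−T)/T`, so `|ℓ_{T′} − ℓ_T| ≤ |T′ − T|/min(T,T′)`;
* `bandRadius_sub_bandRadius_eq`, `abs_bandRadius_sub_bandRadius_le`:
  `h − h′ = h·(ℓ_{T′} − ℓ_T)/ℓ_{T′}`, so `|h − h′| ≤ h·|ℓ_{T′} − ℓ_T|/ℓ_{T′}` (astronomically small on
  the top shell, `T ≥ e^{3k}`, but quantitative — the slack for `½ ≤ h′` is `4/c − ½ = 2a₀(c)`);
* `near_point_regime`: the pins (`|Re v| ≤ ½`, `Im v ≥ 100`, `ℓ ≥ 100`, `½ ≤ h′ ≤ 20`, `h′ ≤ 7T′/20`,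
  `|ℓ′ − ℓ| ≤ 10⁻⁴`, `|h − h′| ≤ 1/T`) at every point of the `3/ℓ_T`-disc about a pinned centre
  `x + iT` (`|x| ≤ 9/20`, `T, ℓ_T ≥ 200`, `½ + s ≤ h ≤ 1`, slack `s ≥ 1/T`).
-/

noncomputable section

-- single-problem summit: `Summit.RiemannHypothesis.RiemannHypothesis.…` is the tree convention
set_option linter.dupNamespace false

open Real Complex

namespace Summit.RiemannHypothesis.RiemannHypothesis.Theorems.JensenPolynomials.LogBandArc

/-- `ℓ_{T′} − ℓ_T = log(T′/T)`. [folklore] -/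
theorem ell_sub_ell_eq_log {T T' : ℝ} (hT : 0 < T) (hT' : 0 < T') :
    ell T' - ell T = Real.log (T' / T) := by
  rw [ell, ell, ← Real.log_div (by positivity) (by positivity)]
  congr 1
  field_simp

/-- `ℓ_{T′} − ℓ_T ≤ (T′ − T)/T`. [folklore] -/
theorem ell_sub_ell_le {T T' : ℝ} (hT : 0 < T) (hT' : 0 < T') :
    ell T' - ell T ≤ (T' - T) / T := by
  rw [ell_sub_ell_eq_log hT hT']
  have h := Real.log_le_sub_one_of_pos (show 0 < T' / T by positivity)
  have e : T' / T - 1 = (T' - T) / T := by field_simp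
  linarith

/-- `(T′ − T)/T′ ≤ ℓ_{T′} − ℓ_T`. [folklore] -/
theorem le_ell_sub_ell {T T' : ℝ} (hT : 0 < T) (hT' : 0 < T') :
    (T' - T) / T' ≤ ell T' - ell T := by
  rw [ell_sub_ell_eq_log hT hT']
  have h := Real.one_sub_inv_le_log_of_pos (show 0 < T' / T by positivity)
  have e : 1 - (T' / T)⁻¹ = (T' - T) / T' := by field_simp
  linarith

/-- `|ℓ_{T′} − ℓ_T| ≤ |T′ − T| / min(T, T′)`. [folklore] -/
theorem abs_ell_sub_ell_le {T T' : ℝ} (hT : 0 < T) (hT' : 0 < T') :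
    |ell T' - ell T| ≤ |T' - T| / min T T' := by
  have hm : 0 < min T T' := lt_min hT hT'
  have hmT : min T T' ≤ T := min_le_left _ _
  have hmT' : min T T' ≤ T' := min_le_right _ _
  have hup := ell_sub_ell_le hT hT'
  have hlo := le_ell_sub_ell hT hT'
  have h1 : |(T' - T) / T'| ≤ |T' - T| / min T T' := by
    rw [abs_div, abs_of_pos hT']
    exact div_le_div_of_nonneg_left (abs_nonneg _) hm hmT'
  have h2 : |(T' - T) / T| ≤ |T' - T| / min T T' := by
    rw [abs_div, abs_of_pos hT]
    exact div_le_div_of_nonneg_left (abs_nonneg _) hm hmT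
  rw [abs_le]
  constructor
  · linarith [neg_abs_le ((T' - T) / T')]
  · linarith [le_abs_self ((T' - T) / T)]

/-- `h − h′ = h · (ℓ_{T′} − ℓ_T)/ℓ_{T′}` for the band radii at two heights (log-heights non-zero).
[folklore] -/
theorem bandRadius_sub_bandRadius_eq (n : ℕ) {T T' : ℝ} (hℓ : ell T ≠ 0) (hℓ' : ell T' ≠ 0) :
    bandRadius n T - bandRadius n T' = bandRadius n T * (ell T' - ell T) / ell T' := by
  rw [bandRadius, bandRadius, div_sub_div _ _ hℓ hℓ', mul_div_assoc, div_mul_div_comm, div_eq_div_iff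
    (mul_ne_zero hℓ hℓ') (mul_ne_zero hℓ hℓ')]
  ring

/-- `|h − h′| ≤ h · |ℓ_{T′} − ℓ_T| / ℓ_{T′}` (both log-heights positive). [folklore] -/
theorem abs_bandRadius_sub_bandRadius_le (n : ℕ) {T T' : ℝ} (hℓ : 0 < ell T) (hℓ' : 0 < ell T') :
    |bandRadius n T - bandRadius n T'| ≤ bandRadius n T * |ell T' - ell T| / ell T' := by
  rw [bandRadius_sub_bandRadius_eq n hℓ.ne' hℓ'.ne', abs_div, abs_mul, abs_of_pos hℓ',
    abs_of_nonneg (show 0 ≤ bandRadius n T by rw [bandRadius]; positivity)]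

/-! ## The regime pins at a near point (transfer discs of the near zone) -/

/-- **Regime at a disc point.** If `v₀ = x + iT` carries the pins `|x| ≤ 9/20`, `T ≥ 200`,
`ℓ_T ≥ 200`, `½ + s ≤ h ≤ 1` with a slack `s ≥ 1/T` (on the BAND line `s = 4/c − ½ = 2a₀(c)` and
`1/T ≤ e^{−3k} ≤ 2a₀` eventually), then every `v` with `‖v − v₀‖ ≤ 3/ℓ_T` carries the pins of the
window / saddle lemmas at its own height `T′ = Im v`: `|Re v| ≤ ½`, `T′ ≥ 100`,
`|ℓ_{T′} − ℓ_T| ≤ 10⁻⁴` (so `ℓ_{T′} ≥ 100`), `|h − h′| ≤ 1/T ≤ s` (so `½ ≤ h′ ≤ 20`, `h′ ≤ 7T′/20`).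
[folklore] -/
theorem near_point_regime (k : ℕ) {x T s : ℝ} {v : ℂ} (hx : |x| ≤ 9 / 20) (hT : 200 ≤ T)
    (hℓ : 200 ≤ ell T) (hs : 1 / T ≤ s) (hh : 1 / 2 + s ≤ bandRadius k T)
    (hH : bandRadius k T ≤ 1) (hv : ‖v - ((x : ℂ) + (T : ℂ) * I)‖ ≤ 3 / ell T) :
    |v.re| ≤ 1 / 2 ∧ 100 ≤ v.im ∧ |ell v.im - ell T| ≤ 1 / 10000 ∧ 100 ≤ ell v.im ∧
      |bandRadius k T - bandRadius k v.im| ≤ 1 / T ∧ 1 / 2 ≤ bandRadius k v.im ∧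
      bandRadius k v.im ≤ 20 ∧ bandRadius k v.im ≤ 7 / 20 * v.im := by
  set v₀ : ℂ := (x : ℂ) + (T : ℂ) * I with hv₀
  have hT0 : 0 < T := by linarith
  have hℓ0 : 0 < ell T := by linarith
  -- the displacement is at most `3/200` in each coordinate
  have h3 : 3 / ell T ≤ 3 / 200 := div_le_div_of_nonneg_left (by norm_num) (by norm_num) hℓ
  have hd : ‖v - v₀‖ ≤ 3 / 200 := hv.trans h3
  have hre : |v.re - x| ≤ 3 / 200 := by
    have e : v.re - x = (v - v₀).re := by simp [hv₀]
    rw [e]; exact (Complex.abs_re_le_norm _).trans hd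
  have him : |v.im - T| ≤ 3 / 200 := by
    have e : v.im - T = (v - v₀).im := by simp [hv₀]
    rw [e]; exact (Complex.abs_im_le_norm _).trans hd
  have hre' := abs_le.1 hre
  have him' := abs_le.1 him
  have hx' := abs_le.1 hx
  set T' : ℝ := v.im with hT'
  have hT'0 : 0 < T' := by linarith
  have hT'100 : 100 ≤ T' := by linarith
  -- log-height perturbation `|ℓ' − ℓ| ≤ (3/200)/(T − 3/200) ≤ 10⁻⁴`
  have hmin : T - 3 / 200 ≤ min T T' := le_min (by linarith) (by linarith)
  have hmin0 : 0 < T - 3 / 200 := by linarith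
  have hE : |ell T' - ell T| ≤ 3 / 200 / (T - 3 / 200) := by
    have h1 := abs_ell_sub_ell_le hT0 hT'0
    have h2 : |T' - T| / min T T' ≤ 3 / 200 / min T T' :=
      div_le_div_of_nonneg_right him (by linarith)
    have h3 : 3 / 200 / min T T' ≤ 3 / 200 / (T - 3 / 200) :=
      div_le_div_of_nonneg_left (by norm_num) hmin0 hmin
    linarith
  have hE4 : 3 / 200 / (T - 3 / 200) ≤ 1 / 10000 := by
    rw [div_le_iff₀ hmin0]; linarith
  have hℓ' : |ell T' - ell T| ≤ 1 / 10000 := hE.trans hE4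
  have hℓ'' := abs_le.1 hℓ'
  have hℓ'100 : 100 ≤ ell T' := by linarith
  have hℓ'0 : 0 < ell T' := by linarith
  -- radius perturbation `|h − h'| ≤ h |ℓ'−ℓ| / ℓ' ≤ (3/200)/((T − 3/200)·100) ≤ 1/T`
  have hh0 : 0 ≤ bandRadius k T := by rw [bandRadius]; positivity
  have hhd : |bandRadius k T - bandRadius k T'| ≤ 1 / T := by
    have h1 := abs_bandRadius_sub_bandRadius_le k hℓ0 hℓ'0
    have h2 : bandRadius k T * |ell T' - ell T| / ell T' ≤
        bandRadius k T * |ell T' - ell T| / 100 :=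
      div_le_div_of_nonneg_left (by positivity) (by norm_num) hℓ'100
    have h3 : bandRadius k T * |ell T' - ell T| ≤ 1 * (3 / 200 / (T - 3 / 200)) :=
      mul_le_mul hH hE (abs_nonneg _) (by norm_num)
    have h4 : 1 * (3 / 200 / (T - 3 / 200)) / 100 ≤ 1 / T := by
      rw [one_mul, div_div, div_le_div_iff₀ (by positivity) hT0]
      nlinarith
    have h5 : bandRadius k T * |ell T' - ell T| / 100 ≤ 1 * (3 / 200 / (T - 3 / 200)) / 100 :=
      div_le_div_of_nonneg_right h3 (by norm_num)
    linarith
  have hhd' := abs_le.1 hhd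
  have h1T : 1 / T ≤ 1 / 200 := div_le_div_of_nonneg_left (by norm_num) (by norm_num) hT
  refine ⟨?_, hT'100, hℓ', hℓ'100, hhd, ?_, ?_, ?_⟩
  · rw [abs_le]; constructor <;> linarith
  · linarith
  · linarith
  · linarith

end Summit.RiemannHypothesis.RiemannHypothesis.Theorems.JensenPolynomials.LogBandArc

end
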